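import Summits.QuantumFields.BalabanUV.Beta.GAN24.VHSlotProfile

/-!
# `BalabanUV.Beta.GAN24.VHWordsZeroBorder` — binder row G-an2-4 ∕ (CONV-C), W-slot CT-W, conservation law (C)∕(C)sym, step (L3) of this lineage's note
# `HOME/b2b-balaban-gan24-formalise-leaf-04/g65/CSYM-LEVEL0-KERNEL-BLUEPRINT.md` §6 («VH words: located open»): **THE `S^VH ⊗ S^VH` WORDS OF THE DRESSED SOURCE VANISH, BOND BY
# BOND, AT EVERY LEVEL `j`** — both border slots have no ff block, so the word runs through the mm block of `X̃♮_j` between them; the lattice-summed border slot is a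
# block-periodic, coarsely supported multiplier-leg profile (`VHSlotProfile`), against which the mm block of `X̃♮_j` reads its mm COLUMN CHARGE — zero ((S2c),
# `DressedStepFaceCharges.hasSum_dressedStep_col` on a multiplier leg)

NOT IN PRINT; OUR BOOKKEEPING ([folklore] BY NAME over this lineage's `VHSlotProfile ∕ VHWordsZeroLattice ∕ ExchangeSlotResum`, an2's kernel calculus (`vertexOfK`, `BalabanStepJetsSucc.vertexOfK_translate_block`),
leaf-02's `BubbleParity ∕ LayerCommutatorAntisymm` (`sgnK`, `trK X̃ = sgnK X̃`), an5's `TameKernelCalculus`; G-an2-4 formalisation swarm, leaf prover `b2b-balaban-gan24-formalise-leaf-04`, gen 66).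
HONEST FRAMING (cell contract, verbatim): «discharging `BetaPertH` makes Bałaban's UV stability UNCONDITIONAL — a real constructive-QFT result; it is NOT the continuum limit and NOT the
Clay problem.»  HONEST DEPENDENCY (verbatim): «continuum YM on T⁴ ⇐ BetaPertH ∧ nine spine estimates (0/9 proved); BetaPertH ⇐ (D1) ∧ (D4) ∧ CAP+tail; G-an2-4 gates asym, D1 and
NE2/3/4.»

WHAT ([folklore]; generic `d`, in-block root `ρ = toSite r`, `1 ≤ Lc`, EVERY level `j`, all units; ANY local stencil families `S′` (lattice slot) and `S″` (cell slot) with ZERO ff block,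
`S′` block-covariant with its multiplier legs on the coarse lattice — an1's `vhSAt ρ` (`packVH`) has all three properties; any axes, any cell bond `c`, any bounded `Lc`-periodic leg weights;
0 `def`, 0 cited facts, 0 `def … : Prop`, 0 sorry; `X̃♮_j = unitK s_f s_m (coDressKBmAt ρ Lc (KInvStep Lc j))`, `Q_{ν,u} = vertexOfK X̃♮_j Lc (unitS s_f s_m S′) ν u`,
`P_{μ,c} = vertexOfK X̃♮_j Lc (unitS s_f s_m S″) μ c`): §1 the slot family's data — `unitS_translate_block`, `borderSlot_translate` (block covariance), `borderSlot_inr_fst_eq_zero ∕ _inr_snd_eq_zero`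
(coarse support of the multiplier legs), `hasSum_dressedStep_mm_col ∕ hasSum_sgnK_dressedStep_mm_col` (ZERO mm column charge of `X̃♮_j` and of `sgnK X̃♮_j`), `exists_border_data` (one rate);
§2 **`tsum_border_border_word_eq_zero`** (DIRECT: `Σ'_{u′} Σ'_{(y,w)} ρ₁(y)ρ₂(w)·((P_{μ,c} ∘ X̃♮_j) ∘ Q_{ν,u′}) y w (inl α)(inl β) = 0`), **`tsum_border_border_swap_word_eq_zero`** (SWAP:
`Σ'_{u′} FF[(Q_{ν,u′} ∘ X̃♮_j) ∘ P_{μ,c}] = 0`, by transposition through `sgnK X̃♮_j`), `sum_box_border_border_words_eq_zero` (both cell-and-lattice sums of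
`DressedSourceZeroModeWords.zmode_dressedSource_inl_inl`).  Asserts NO value of Bałaban's tables beyond an1's DEFINED border table; discharges NOTHING of (C)sym ∕ (Q-D) ∕ (Q-D-rate) ∕
«T2Shape» ∕ «T2Drift» ∕ (hW, hWall); NEVER «G-an2-4 closed» as (CONV-C); NOT D1, NOT `BetaPertH`, NOT continuum, NOT Clay.  2026-08-23; no existing file touched.
-/

noncomputable section

open Finset
open scoped BigOperators
open Literature.MathematicalPhysics.QuantumFieldTheory
open Literature.MathematicalPhysics.QuantumFieldTheory.Balaban1983to89
open Literature.MathematicalPhysics.QuantumFieldTheory.Balaban1983to89.Beta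
open ExpKernelCalculus (Site MKer comp shiftK Decays BiLoc VertexFamily)
open OneStepResolventKernel (Fib LocStencil wsum decays_mono biLoc_mono)
open BalabanStepJetsSucc (biLoc_comp_right vertexOfK_translate_block)
open OneStepKernelFamily (KInvStep vertexOfK vertexFamily_vertexOfK decays_KInvStep)
open AffineAveraging (box toSite)
open AveragingContours (off)
open Summit.QuantumFields.BalabanUV.Beta.TameKernelCalculus (trK trK_apply trK_comp biLoc_trK Loc Spr Tame comp_assoc_tame)
open Summit.QuantumFields.BalabanUV.Beta.BorderedHessian (sgnK sgnK_apply sgnF_inl sgnF_inr decays_sgnK)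
open Summit.QuantumFields.BalabanUV.Beta.AxialDressingRooted (coDressKBmAt decays_coDressKBmAt)
open Summit.QuantumFields.BalabanUV.Beta.HessKerDressedUnits (unitK unitS unitS_apply decays_unitK locStencil_unitS)
open Summit.QuantumFields.BalabanUV.Beta.GAN24.EEWordReduced (shiftK_dressedStep)
open Summit.QuantumFields.BalabanUV.Beta.GAN24.DressedStepFaceCharges (hasSum_dressedStep_col)
open Summit.QuantumFields.BalabanUV.Beta.GAN24.LayerCommutatorAntisymm (trK_unitK_coDress)
open Summit.QuantumFields.BalabanUV.Beta.GAN24.ExchangeSlotResum (tsum_twoFace_eq_trK)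
open Summit.QuantumFields.BalabanUV.Beta.GAN24.VHWordsZeroLattice (vertexOfK_unitS_noFF_inl_inl)
open Summit.QuantumFields.BalabanUV.Beta.GAN24.VHSlotProfile (tsum_noFF_left_profile_right_word_eq_zero_of)

namespace Summit.QuantumFields.BalabanUV.Beta.GAN24.VHWordsZeroBorder

variable {d : ℕ} {Lc : ℕ} [NeZero Lc] {r : Fin (d + 1) → ℕ}
variable {S' S'' : Fin (d + 1) → Site (d + 1) → MKer (d + 1) (Fib d)} {Cs δs Cs' δs' : ℝ} {ρ₁ ρ₂ : Site (d + 1) → ℝ} {μ ν α β : Fin (d + 1)}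

/-! ## §1 Data of the border slot family -/

omit [NeZero Lc] in
/-- [folklore] Block covariance passes through the change of units of a stencil table. -/
theorem unitS_translate_block (sf sm : ℝ) (hScov : ∀ (κ : Fin (d + 1)) (u t : Site (d + 1)), S' κ (u + (Lc : ℤ) • t) = shiftK (-((Lc : ℤ) • t)) (S' κ u))
    (κ : Fin (d + 1)) (u t : Site (d + 1)) : unitS sf sm S' κ (u + (Lc : ℤ) • t) = shiftK (-((Lc : ℤ) • t)) (unitS sf sm S' κ u) := by
  funext x z a b
  simp only [unitS_apply, hScov, shiftK]

/-- [folklore] **THE BORDER SLOT FAMILY IS BLOCK-COVARIANT**: `Q_{ν,u+s} = shiftK (−Lc•s) Q_{ν,u}` (`vertexOfK_translate_block` with `EEWordReduced.shiftK_dressedStep`). -/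
theorem borderSlot_translate (hLc : 1 ≤ Lc) (sf sm : ℝ) (j : ℕ)
    (hScov : ∀ (κ : Fin (d + 1)) (u t : Site (d + 1)), S' κ (u + (Lc : ℤ) • t) = shiftK (-((Lc : ℤ) • t)) (S' κ u)) (ν : Fin (d + 1)) (u s : Site (d + 1)) :
    vertexOfK (unitK sf sm (coDressKBmAt (toSite r) Lc (KInvStep (d := d) Lc j))) Lc (unitS sf sm S') ν (u + s) =
      shiftK (-((Lc : ℤ) • s)) (vertexOfK (unitK sf sm (coDressKBmAt (toSite r) Lc (KInvStep (d := d) Lc j))) Lc (unitS sf sm S') ν u) :=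
  vertexOfK_translate_block (fun t => shiftK_dressedStep (r := r) hLc sf sm j t) (unitS_translate_block sf sm hScov) ν u s

omit [NeZero Lc] in
/-- [folklore] **COARSE SUPPORT OF THE MULTIPLIER FIRST LEG** passes from the table to the slot. -/
theorem borderSlot_inr_fst_eq_zero (X : MKer (d + 1) (Fib d)) (sf sm : ℝ)
    (hSsupp : ∀ (κ : Fin (d + 1)) (t z w : Site (d + 1)) (m : Fin (d + 1)) (b : Fib d), off Lc z ≠ 0 → S' κ t z w (Sum.inr m) b = 0)
    (ν : Fin (d + 1)) (u z w : Site (d + 1)) (m : Fin (d + 1)) (b : Fib d) (hz : off Lc z ≠ 0) :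
    vertexOfK X Lc (unitS sf sm S') ν u z w (Sum.inr m) b = 0 := by
  simp only [vertexOfK, wsum, unitS_apply, hSsupp _ _ _ _ m b hz, mul_zero, zero_mul, tsum_zero, Finset.sum_const_zero]

omit [NeZero Lc] in
/-- [folklore] **COARSE SUPPORT OF THE MULTIPLIER SECOND LEG** passes from the table to the slot. -/
theorem borderSlot_inr_snd_eq_zero (X : MKer (d + 1) (Fib d)) (sf sm : ℝ)
    (hSsupp : ∀ (κ : Fin (d + 1)) (t z w : Site (d + 1)) (a : Fib d) (m : Fin (d + 1)), off Lc w ≠ 0 → S' κ t z w a (Sum.inr m) = 0)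
    (ν : Fin (d + 1)) (u z w : Site (d + 1)) (a : Fib d) (m : Fin (d + 1)) (hw : off Lc w ≠ 0) :
    vertexOfK X Lc (unitS sf sm S') ν u z w a (Sum.inr m) = 0 := by
  simp only [vertexOfK, wsum, unitS_apply, hSsupp _ _ _ _ a m hw, mul_zero, zero_mul, tsum_zero, Finset.sum_const_zero]

/-- [folklore] **THE mm COLUMN CHARGE OF THE DRESSED STEP KERNEL VANISHES** (every `j`; (S2c) through `DressedStepFaceCharges.hasSum_dressedStep_col` on a multiplier leg). -/
theorem hasSum_dressedStep_mm_col (hLc : 1 ≤ Lc) (hr : r ∈ box (d + 1) Lc) (sf sm : ℝ) (j : ℕ) (y₁ : Site (d + 1)) (m m' : Fin (d + 1)) :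
    HasSum (fun z' : Site (d + 1) => unitK sf sm (coDressKBmAt (toSite r) Lc (KInvStep (d := d) Lc j)) y₁ ((Lc : ℤ) • z') (Sum.inr m') (Sum.inr m)) 0 := by
  have h := hasSum_dressedStep_col (d := d) hLc hr sf sm j m (Sum.inr m') y₁
  simpa only [Sum.elim_inr] using h

/-- [folklore] … and so does that of `sgnK X̃♮_j` (the mm block of `sgnK` is the mm block). -/
theorem hasSum_sgnK_dressedStep_mm_col (hLc : 1 ≤ Lc) (hr : r ∈ box (d + 1) Lc) (sf sm : ℝ) (j : ℕ) (y₁ : Site (d + 1)) (m m' : Fin (d + 1)) :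
    HasSum (fun z' : Site (d + 1) => sgnK (unitK sf sm (coDressKBmAt (toSite r) Lc (KInvStep (d := d) Lc j))) y₁ ((Lc : ℤ) • z') (Sum.inr m') (Sum.inr m)) 0 := by
  have h := hasSum_dressedStep_mm_col hLc hr sf sm j y₁ m m'
  refine h.congr_fun fun z' => ?_
  rw [sgnK_apply, sgnF_inr, sgnF_inr]
  ring

/-- [folklore] **COMMON-RATE DATA** for a left table `S″`, the slot table `S′` and the kernel: one rate `δ` with `X̃♮_j` decaying, both vertex families bi-localised, and `P_{μ,c} ∘ X̃♮_j`,
`trK P_{μ,c} ∘ sgnK X̃♮_j` bi-localised at `(Lc•c, Lc•c)`. -/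
theorem exists_border_data (hLc : 1 ≤ Lc) (hr : r ∈ box (d + 1) Lc) (sf sm : ℝ) (j : ℕ) (hS' : LocStencil S' Cs δs) (hδs : 0 < δs) (hS'' : LocStencil S'' Cs' δs')
    (hδs' : 0 < δs') (μ : Fin (d + 1)) (c : Site (d + 1)) :
    ∃ δ CX Cq Cp CA CB : ℝ, 0 < δ ∧
      Decays (unitK sf sm (coDressKBmAt (toSite r) Lc (KInvStep (d := d) Lc j))) CX δ ∧
      VertexFamily (vertexOfK (unitK sf sm (coDressKBmAt (toSite r) Lc (KInvStep (d := d) Lc j))) Lc (unitS sf sm S')) Lc Cq δ ∧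
      VertexFamily (vertexOfK (unitK sf sm (coDressKBmAt (toSite r) Lc (KInvStep (d := d) Lc j))) Lc (unitS sf sm S'')) Lc Cp δ ∧
      BiLoc (comp (vertexOfK (unitK sf sm (coDressKBmAt (toSite r) Lc (KInvStep (d := d) Lc j))) Lc (unitS sf sm S'') μ c)
        (unitK sf sm (coDressKBmAt (toSite r) Lc (KInvStep (d := d) Lc j)))) ((Lc : ℤ) • c) ((Lc : ℤ) • c) CA δ ∧
      BiLoc (comp (trK (vertexOfK (unitK sf sm (coDressKBmAt (toSite r) Lc (KInvStep (d := d) Lc j))) Lc (unitS sf sm S'') μ c))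
        (sgnK (unitK sf sm (coDressKBmAt (toSite r) Lc (KInvStep (d := d) Lc j))))) ((Lc : ℤ) • c) ((Lc : ℤ) • c) CB δ := by
  obtain ⟨δK, CK, hδK, hCK, hXd⟩ := decays_coDressKBmAt hLc hr (decays_KInvStep (d := d) (Lc := Lc) j)
  have hXu := decays_unitK (sf := sf) (sm := sm) hXd
  have hCX : 0 ≤ max |sf| |sm| * CK * max |sf| |sm| := by positivity
  have hCs : 0 ≤ Cs := (hS' 0 0).nonneg (Sum.inl 0)
  have hCs' : 0 ≤ Cs' := (hS'' 0 0).nonneg (Sum.inl 0)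
  set δ₁ : ℝ := min δK (min δs δs') with hδ₁
  have hδ₁0 : 0 < δ₁ := lt_min hδK (lt_min hδs hδs')
  have h1K : δ₁ ≤ δK := min_le_left _ _
  have h1s : δ₁ ≤ δs := (min_le_right _ _).trans (min_le_left _ _)
  have h1s' : δ₁ ≤ δs' := (min_le_right _ _).trans (min_le_right _ _)
  have hX1 : Decays (unitK sf sm (coDressKBmAt (toSite r) Lc (KInvStep (d := d) Lc j))) (max |sf| |sm| * CK * max |sf| |sm|) δ₁ := decays_mono hXu hCX le_rfl h1K
  have hQ := vertexFamily_vertexOfK (N := Lc) hX1 hCX (locStencil_unitS (sf := sf) (sm := sm) (fun κ u => biLoc_mono (hS' κ u) hCs h1s)) hδ₁0 le_rfl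
  have hP := vertexFamily_vertexOfK (N := Lc) hX1 hCX (locStencil_unitS (sf := sf) (sm := sm) (fun κ u => biLoc_mono (hS'' κ u) hCs' h1s')) hδ₁0 le_rfl
  have hCq := (hQ μ 0).nonneg (Sum.inl 0)
  have hCp := (hP μ 0).nonneg (Sum.inl 0)
  have hX2 : Decays (unitK sf sm (coDressKBmAt (toSite r) Lc (KInvStep (d := d) Lc j))) (max |sf| |sm| * CK * max |sf| |sm|) (δ₁ / 2) := decays_mono hX1 hCX le_rfl (by linarith)
  have hA := biLoc_comp_right (hP μ c) hX2 (show (0 : ℝ) ≤ δ₁ / 4 by positivity) (by linarith)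
  have hB := biLoc_comp_right (biLoc_trK (hP μ c)) (decays_sgnK hX2) (show (0 : ℝ) ≤ δ₁ / 4 by positivity) (by linarith)
  exact ⟨δ₁ / 4, _, _, _, _, _, by positivity, decays_mono hX1 hCX le_rfl (by linarith), fun κ v => biLoc_mono (hQ κ v) hCq (by linarith),
    fun κ v => biLoc_mono (hP κ v) hCp (by linarith), hA, hB⟩

/-! ## §2 The `S″ ⊗ S′` words with both tables free of the ff block: zero, bond by bond, every level -/

/-- [folklore] **THE BORDER ⊗ BORDER DIRECT WORD VANISHES BOND BY BOND** (every level `j`, in-block root, `1 ≤ Lc`, all units, any axes, any `c`; `S″` any local stencil family with no ff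
block; `S′` any block-covariant local stencil family with no ff block and multiplier legs on the coarse lattice; `|ρ₁|, |ρ₂| ≤ 1`, `ρ₂` `Lc`-periodic):
`Σ'_{u′} Σ'_{(y,w)} ρ₁(y)ρ₂(w)·((P_{μ,c} ∘ X̃♮_j) ∘ Q_{ν,u′}) y w (inl α)(inl β) = 0` — `VHSlotProfile.tsum_noFF_left_profile_right_word_eq_zero_of` with the zero mm column charge of `X̃♮_j`. -/
theorem tsum_border_border_word_eq_zero (hLc : 1 ≤ Lc) (hr : r ∈ box (d + 1) Lc) (sf sm : ℝ) (j : ℕ) (hS' : LocStencil S' Cs δs) (hδs : 0 < δs)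
    (hS'ff : ∀ (κ' : Fin (d + 1)) (t x z : Site (d + 1)) (α' a : Fin (d + 1)), S' κ' t x z (Sum.inl α') (Sum.inl a) = 0)
    (hS'cov : ∀ (κ : Fin (d + 1)) (u t : Site (d + 1)), S' κ (u + (Lc : ℤ) • t) = shiftK (-((Lc : ℤ) • t)) (S' κ u))
    (hS'supp : ∀ (κ : Fin (d + 1)) (t z w : Site (d + 1)) (m : Fin (d + 1)) (b : Fib d), off Lc z ≠ 0 → S' κ t z w (Sum.inr m) b = 0)
    (hS'' : LocStencil S'' Cs' δs') (hδs' : 0 < δs') (hS''ff : ∀ (κ' : Fin (d + 1)) (t x z : Site (d + 1)) (α' a : Fin (d + 1)), S'' κ' t x z (Sum.inl α') (Sum.inl a) = 0)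
    (h₁ : ∀ y, |ρ₁ y| ≤ 1) (h₂ : ∀ w, |ρ₂ w| ≤ 1) (hρ₂ : ∀ w s : Site (d + 1), ρ₂ (w + (Lc : ℤ) • s) = ρ₂ w) (c : Site (d + 1)) :
    ∑' u' : Site (d + 1), ∑' yw : Site (d + 1) × Site (d + 1), ρ₁ yw.1 * ρ₂ yw.2 *
        comp (comp (vertexOfK (unitK sf sm (coDressKBmAt (toSite r) Lc (KInvStep (d := d) Lc j))) Lc (unitS sf sm S'') μ c)
          (unitK sf sm (coDressKBmAt (toSite r) Lc (KInvStep (d := d) Lc j))))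
          (vertexOfK (unitK sf sm (coDressKBmAt (toSite r) Lc (KInvStep (d := d) Lc j))) Lc (unitS sf sm S') ν u') yw.1 yw.2 (Sum.inl α) (Sum.inl β) = 0 := by
  obtain ⟨δ, CX, Cq, Cp, CA, CB, hδ, hX, hQ, hP, hA, -⟩ := exists_border_data hLc hr sf sm j hS' hδs hS'' hδs' μ c
  exact tsum_noFF_left_profile_right_word_eq_zero_of (N := Lc) hδ (hP μ c) (fun y z α' a => vertexOfK_unitS_noFF_inl_inl _ Lc sf sm hS''ff μ c y z α' a) hX
    (fun y₁ m m' => hasSum_dressedStep_mm_col hLc hr sf sm j y₁ m m') hA (fun u => hQ ν u) (fun u s => borderSlot_translate (r := r) hLc sf sm j hS'cov ν u s)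
    (fun u z w b' b => vertexOfK_unitS_noFF_inl_inl _ Lc sf sm hS'ff ν u z w b' b) (fun u z w m b hz => borderSlot_inr_fst_eq_zero _ sf sm hS'supp ν u z w m b hz) h₁ h₂ hρ₂

/-- [folklore] **THE BORDER ⊗ BORDER SWAP WORD VANISHES BOND BY BOND**: `Σ'_{u′} Σ'_{(y,w)} ρ₁(y)ρ₂(w)·((Q_{ν,u′} ∘ X̃♮_j) ∘ P_{μ,c}) y w (inl α)(inl β) = 0` (here `S′`'s multiplier SECOND
legs sit on the coarse lattice and `ρ₁` is `Lc`-periodic) — by transposition: the pair sum at `(α, β)` is that of `trK` at `(β, α)` (`ExchangeSlotResum.tsum_twoFace_eq_trK`), `trK` reverses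
the word (`trK_comp`), `trK X̃♮_j = sgnK X̃♮_j` (`LayerCommutatorAntisymm.trK_unitK_coDress`), `trK Q_{ν,u′}` is the slot family over the transposed table (again block-covariant, no ff
block, multiplier FIRST legs coarse), and `sgnK X̃♮_j` has the same (zero) mm column charge; then §2's direct lemma in generic form. -/
theorem tsum_border_border_swap_word_eq_zero (hLc : 1 ≤ Lc) (hr : r ∈ box (d + 1) Lc) (sf sm : ℝ) (j : ℕ) (hS' : LocStencil S' Cs δs) (hδs : 0 < δs)
    (hS'ff : ∀ (κ' : Fin (d + 1)) (t x z : Site (d + 1)) (α' a : Fin (d + 1)), S' κ' t x z (Sum.inl α') (Sum.inl a) = 0)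
    (hS'cov : ∀ (κ : Fin (d + 1)) (u t : Site (d + 1)), S' κ (u + (Lc : ℤ) • t) = shiftK (-((Lc : ℤ) • t)) (S' κ u))
    (hS'supp : ∀ (κ : Fin (d + 1)) (t z w : Site (d + 1)) (a : Fib d) (m : Fin (d + 1)), off Lc w ≠ 0 → S' κ t z w a (Sum.inr m) = 0)
    (hS'' : LocStencil S'' Cs' δs') (hδs' : 0 < δs') (hS''ff : ∀ (κ' : Fin (d + 1)) (t x z : Site (d + 1)) (α' a : Fin (d + 1)), S'' κ' t x z (Sum.inl α') (Sum.inl a) = 0)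
    (h₁ : ∀ y, |ρ₁ y| ≤ 1) (h₂ : ∀ w, |ρ₂ w| ≤ 1) (hρ₁ : ∀ y s : Site (d + 1), ρ₁ (y + (Lc : ℤ) • s) = ρ₁ y) (c : Site (d + 1)) :
    ∑' u' : Site (d + 1), ∑' yw : Site (d + 1) × Site (d + 1), ρ₁ yw.1 * ρ₂ yw.2 *
        comp (comp (vertexOfK (unitK sf sm (coDressKBmAt (toSite r) Lc (KInvStep (d := d) Lc j))) Lc (unitS sf sm S') ν u')
          (unitK sf sm (coDressKBmAt (toSite r) Lc (KInvStep (d := d) Lc j))))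
          (vertexOfK (unitK sf sm (coDressKBmAt (toSite r) Lc (KInvStep (d := d) Lc j))) Lc (unitS sf sm S'') μ c) yw.1 yw.2 (Sum.inl α) (Sum.inl β) = 0 := by
  classical
  set X := unitK sf sm (coDressKBmAt (toSite r) Lc (KInvStep (d := d) Lc j)) with hX
  set Q := vertexOfK X Lc (unitS sf sm S') ν with hQdef
  set P := vertexOfK X Lc (unitS sf sm S'') μ c with hPdef
  obtain ⟨δ, CX, Cq, Cp, CA, CB, hδ, hXd, hQf, hPf, -, hB⟩ := exists_border_data hLc hr sf sm j hS' hδs hS'' hδs' μ c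
  have hXt : trK X = sgnK X := trK_unitK_coDress hr j sf sm
  -- tameness for the re-association
  have hTP : Tame (trK P) := Loc.tame ⟨_, _, _, _, hδ, biLoc_trK (hPf μ c)⟩
  have hTX : Tame (sgnK X) := Spr.tame ⟨_, _, hδ, decays_sgnK hXd⟩
  have hTQ : ∀ u' : Site (d + 1), Tame (trK (Q u')) := fun u' => Loc.tame ⟨_, _, _, _, hδ, biLoc_trK (hQf ν u')⟩
  -- per bond: transpose
  have e : ∀ u' : Site (d + 1), (∑' yw : Site (d + 1) × Site (d + 1), ρ₁ yw.1 * ρ₂ yw.2 * comp (comp (Q u') X) P yw.1 yw.2 (Sum.inl α) (Sum.inl β)) =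
      ∑' wy : Site (d + 1) × Site (d + 1), ρ₂ wy.1 * ρ₁ wy.2 * comp (comp (trK P) (sgnK X)) (trK (Q u')) wy.1 wy.2 (Sum.inl β) (Sum.inl α) := by
    intro u'
    rw [tsum_twoFace_eq_trK (comp (comp (Q u') X) P) ρ₁ ρ₂ (Sum.inl α) (Sum.inl β), trK_comp, trK_comp, hXt, comp_assoc_tame hTP hTX (hTQ u')]
  rw [tsum_congr e]
  -- the transposed slot family and the generic lemma
  refine tsum_noFF_left_profile_right_word_eq_zero_of (N := Lc) (Q := fun u' => trK (Q u')) (ρ₁ := ρ₂) (ρ₂ := ρ₁) hδ (biLoc_trK (hPf μ c))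
    (fun y z α' a => by rw [trK_apply]; exact vertexOfK_unitS_noFF_inl_inl X Lc sf sm hS''ff μ c z y a α') (decays_sgnK hXd)
    (fun y₁ m m' => by rw [hX]; exact hasSum_sgnK_dressedStep_mm_col hLc hr sf sm j y₁ m m') hB (fun u => biLoc_trK (hQf ν u)) (fun u s => ?_)
    (fun u z w b' b => by rw [trK_apply]; exact vertexOfK_unitS_noFF_inl_inl X Lc sf sm hS'ff ν u w z b b')
    (fun u z w m b hz => by rw [trK_apply]; exact borderSlot_inr_snd_eq_zero X sf sm hS'supp ν u w z b m hz) h₂ h₁ hρ₁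
  -- block covariance of the transposed slot
  rw [hQdef, borderSlot_translate (r := r) hLc sf sm j hS'cov ν u s]
  rfl

/-- [folklore] **IN THE ZERO MODE**: both cell-and-lattice sums `Σ_{c ∈ box N} Σ'_{u′}` of the border ⊗ border words vanish (every level `j`). -/
theorem sum_box_border_border_words_eq_zero (hLc : 1 ≤ Lc) (hr : r ∈ box (d + 1) Lc) (sf sm : ℝ) (j : ℕ) (hS' : LocStencil S' Cs δs) (hδs : 0 < δs)
    (hS'ff : ∀ (κ' : Fin (d + 1)) (t x z : Site (d + 1)) (α' a : Fin (d + 1)), S' κ' t x z (Sum.inl α') (Sum.inl a) = 0)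
    (hS'cov : ∀ (κ : Fin (d + 1)) (u t : Site (d + 1)), S' κ (u + (Lc : ℤ) • t) = shiftK (-((Lc : ℤ) • t)) (S' κ u))
    (hS'supp₁ : ∀ (κ : Fin (d + 1)) (t z w : Site (d + 1)) (m : Fin (d + 1)) (b : Fib d), off Lc z ≠ 0 → S' κ t z w (Sum.inr m) b = 0)
    (hS'supp₂ : ∀ (κ : Fin (d + 1)) (t z w : Site (d + 1)) (a : Fib d) (m : Fin (d + 1)), off Lc w ≠ 0 → S' κ t z w a (Sum.inr m) = 0)
    (h₁ : ∀ y, |ρ₁ y| ≤ 1) (h₂ : ∀ w, |ρ₂ w| ≤ 1) (hρ₁ : ∀ y s : Site (d + 1), ρ₁ (y + (Lc : ℤ) • s) = ρ₁ y) (hρ₂ : ∀ w s : Site (d + 1), ρ₂ (w + (Lc : ℤ) • s) = ρ₂ w)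
    (N : ℕ) :
    (∑ c ∈ box (d + 1) N, ∑' u' : Site (d + 1), ∑' yw : Site (d + 1) × Site (d + 1), ρ₁ yw.1 * ρ₂ yw.2 *
        comp (comp (vertexOfK (unitK sf sm (coDressKBmAt (toSite r) Lc (KInvStep (d := d) Lc j))) Lc (unitS sf sm S') μ (toSite c))
          (unitK sf sm (coDressKBmAt (toSite r) Lc (KInvStep (d := d) Lc j))))
          (vertexOfK (unitK sf sm (coDressKBmAt (toSite r) Lc (KInvStep (d := d) Lc j))) Lc (unitS sf sm S') ν u') yw.1 yw.2 (Sum.inl α) (Sum.inl β) = 0) ∧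
    (∑ c ∈ box (d + 1) N, ∑' u' : Site (d + 1), ∑' yw : Site (d + 1) × Site (d + 1), ρ₁ yw.1 * ρ₂ yw.2 *
        comp (comp (vertexOfK (unitK sf sm (coDressKBmAt (toSite r) Lc (KInvStep (d := d) Lc j))) Lc (unitS sf sm S') ν u')
          (unitK sf sm (coDressKBmAt (toSite r) Lc (KInvStep (d := d) Lc j))))
          (vertexOfK (unitK sf sm (coDressKBmAt (toSite r) Lc (KInvStep (d := d) Lc j))) Lc (unitS sf sm S') μ (toSite c)) yw.1 yw.2 (Sum.inl α) (Sum.inl β) = 0) :=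
  ⟨Finset.sum_eq_zero fun c _ => tsum_border_border_word_eq_zero (μ := μ) (ν := ν) (α := α) (β := β) hLc hr sf sm j hS' hδs hS'ff hS'cov hS'supp₁ hS' hδs hS'ff h₁ h₂ hρ₂ (toSite c),
    Finset.sum_eq_zero fun c _ => tsum_border_border_swap_word_eq_zero (μ := μ) (ν := ν) (α := α) (β := β) hLc hr sf sm j hS' hδs hS'ff hS'cov hS'supp₂ hS' hδs hS'ff h₁ h₂ hρ₁ (toSite c)⟩

end Summit.QuantumFields.BalabanUV.Beta.GAN24.VHWordsZeroBorder

end
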